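import Mathlib.Tactic.IntervalCases
import Mathlib.Tactic.NormNum
import Mathlib.Tactic.Ring
import HarnessLib

/-!
# The counting inequalities of the prime-order skew-section theorem: clean size conditions

COR-CM (cell `pub-hodgecm2`), binder seat b04 (gen 33), count-neutral own lane «Galois-CM-type classification».  KERNEL ONLY,
Mathlib only (pure arithmetic in `ℕ`): theorems; no definition, no named fact, no `sorry`.  Companion of
`CorCM/GaloisSkewSectionPrime` (gen 33), whose hypothesis is the count
`|G|·2^(n/2) + m(p-1)·2^((n + n/m)/2) < 2^n` for every `m ≥ m₀` dividing `n` (`|G| = 2pn`, `p` the prime order of the non-normal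
subgroup, `m` its number of conjugates); here that count is derived from clean size conditions:

* `count_of_le_two_pow` — ANY `p ≥ 2`: `16 ≤ n` and `8p ≤ 2^(n/4)` suffice (all `m ≥ 2`).  Cases `m = 2`, `m = 3`, `m ≥ 4`
  (`n/m ≤ n/4`, `m ≤ n`, and `n ≤ 2^(n + 2 - n/4 - (n + n/4)/2)` from `8e ≤ 2^e + 16`).
* `count_three` — `p = 3`: `16 ≤ n`, i.e. `|G| ≥ 96` (`16 ≤ n ≤ 19` by evaluation in `count_three_small`, then the general lemma).
* `count_three_seven_fourteen` — `p = 3`, `n = 14` (`|G| = 84`) with at least `7` conjugates, by evaluation — the row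
  `(C₇ ⋊ C₃) × C₄` of the seat's table.
(For `p = 2` the condition `8p ≤ 2^(n/4)` is `n ≥ 16`, `|G| ≥ 64`: gen 32's threshold.)  Thresholds `count_of_le_two_pow` gives:
`p = 3`: `n ≥ 20`; `p = 5, 7`: `n ≥ 24` (`|G| ≥ 240, 336`); `p = 11, 13`: `n ≥ 28`; in general `n ≥ 4⌈log₂ p⌉ + 12` (ERRATUM to the
first edition of this docstring, which printed `20/200, 280/24` here).  The EXACT thresholds of the `∀m`-count (evaluation): `p = 2`:
`n ≥ 13`; `p = 3`: `n ≥ 14`; `p = 5`: `n ≥ 17` (`|G| ≥ 170`); `p = 7`: `n ≥ 17` (`|G| ≥ 238`); `p = 11, 13`: `n ≥ 21` — the small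
ranges are supplied below by evaluation.
ADDED (gen 33, second pass — the small cases by evaluation): `count_three_of_fourteen_le` (`p = 3`, `n ≥ 14`: `|G| ≥ 84`; `n = 13`
fails), `count_two` (`p = 2`, `n ≥ 13`: `|G| ≥ 52` — gen 32's `64` improved; `n = 12` fails at `m = 2` by equality `2¹² = 2¹²`),
`count_two_twelve` (`p = 2`, `n = 12`, `m ≥ 3`: the row `GL(2,3)`); third pass: `count_five` (`n ≥ 17`), `count_seven` (`n ≥ 17`).

## References

* [Kubota1965] T. Kubota, *On the field extension by complex multiplication*, Trans. AMS 118 (1965), §2 (context only).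
-/

namespace Summit.HodgeConjecture.CorCM.GaloisModels.SkewSectionPrime

/-- `8e ≤ 2^e + 16` for `e ≥ 4`. [folklore] -/
theorem eight_mul_le_two_pow_add (e : ℕ) (he : 4 ≤ e) : 8 * e ≤ 2 ^ e + 16 := by
  induction e, he using Nat.le_induction with
  | base => norm_num
  | succ e he ih =>
    have h8 : 8 ≤ 2 ^ e := by
      calc (8 : ℕ) = 2 ^ 3 := by norm_num
        _ ≤ 2 ^ e := Nat.pow_le_pow_right two_pos (by omega)
    rw [pow_succ]; omega

/-- `n ≤ 2^(n/4 + 1)` for `n ≥ 12`. [folklore] -/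
theorem le_two_pow_div_four_succ (n : ℕ) (hn : 12 ≤ n) : n ≤ 2 ^ (n / 4 + 1) := by
  have h := eight_mul_le_two_pow_add (n / 4 + 1) (by omega)
  omega

/-- **The general count.**  `2 ≤ p`, `16 ≤ n`, `8p ≤ 2^(n/4)` ⟹ for every `m ≥ 2` dividing `n`:
`2pn·2^(n/2) + m(p-1)·2^((n + n/m)/2) < 2^n`. [folklore] -/
theorem count_of_le_two_pow (p n : ℕ) (hp : 2 ≤ p) (hn : 16 ≤ n) (hpa : 8 * p ≤ 2 ^ (n / 4)) :
    ∀ m, 2 ≤ m → m ∣ n → 2 * p * n * 2 ^ (n / 2) + m * (p - 1) * 2 ^ ((n + n / m) / 2) < 2 ^ n := by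
  intro m hm hmn
  have hpow : ∀ e e' : ℕ, e ≤ e' → 2 ^ e ≤ 2 ^ e' := fun e e' h => Nat.pow_le_pow_right two_pos h
  have hmul : ∀ e e' : ℕ, 2 ^ e * 2 ^ e' = 2 ^ (e + e') := fun e e' => (pow_add 2 e e').symm
  -- `T0`: `8pn·2^(n/2) ≤ 2^(n+1)`
  have t0 : 4 * (2 * p * n * 2 ^ (n / 2)) ≤ 2 ^ (n + 1) := by
    have h1 := le_two_pow_div_four_succ n (by omega)
    calc 4 * (2 * p * n * 2 ^ (n / 2)) = 8 * p * n * 2 ^ (n / 2) := by ring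
      _ ≤ 2 ^ (n / 4) * 2 ^ (n / 4 + 1) * 2 ^ (n / 2) :=
          Nat.mul_le_mul_right _ (Nat.mul_le_mul hpa h1)
      _ = 2 ^ (n / 4 + (n / 4 + 1) + n / 2) := by rw [hmul, hmul]
      _ ≤ 2 ^ (n + 1) := hpow _ _ (by omega)
  -- `Tm`: `8·m(p-1)·2^((n + n/m)/2) < 2^(n+2)`
  have tm : 8 * (m * (p - 1) * 2 ^ ((n + n / m) / 2)) < 2 ^ (n + 2) := by
    have hp8 : 8 * (p - 1) < 2 ^ (n / 4) := by omega
    rcases (show m = 2 ∨ m = 3 ∨ 4 ≤ m by omega) with rfl | rfl | hm4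
    · calc 8 * (2 * (p - 1) * 2 ^ ((n + n / 2) / 2)) = 2 * (8 * (p - 1)) * 2 ^ ((n + n / 2) / 2) := by ring
        _ < 2 * 2 ^ (n / 4) * 2 ^ ((n + n / 2) / 2) :=
            Nat.mul_lt_mul_of_pos_right (Nat.mul_lt_mul_of_pos_left hp8 two_pos) (pow_pos two_pos _)
        _ = 2 ^ (1 + n / 4 + (n + n / 2) / 2) := by rw [← hmul, ← hmul, pow_one]
        _ ≤ 2 ^ (n + 2) := hpow _ _ (by omega)
    · calc 8 * (3 * (p - 1) * 2 ^ ((n + n / 3) / 2)) = 3 * (8 * (p - 1)) * 2 ^ ((n + n / 3) / 2) := by ring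
        _ < 3 * 2 ^ (n / 4) * 2 ^ ((n + n / 3) / 2) :=
            Nat.mul_lt_mul_of_pos_right (Nat.mul_lt_mul_of_pos_left hp8 (by norm_num)) (pow_pos two_pos _)
        _ ≤ 4 * 2 ^ (n / 4) * 2 ^ ((n + n / 3) / 2) := Nat.mul_le_mul_right _ (Nat.mul_le_mul_right _ (by norm_num))
        _ = 2 ^ (2 + n / 4 + (n + n / 3) / 2) := by rw [show (4 : ℕ) = 2 ^ 2 by norm_num, hmul, hmul]
        _ ≤ 2 ^ (n + 2) := hpow _ _ (by omega)
    · have hmn' : m ≤ n := Nat.le_of_dvd (by omega) hmn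
      have hdiv : n / m ≤ n / 4 := Nat.div_le_div_left hm4 (by norm_num)
      set e := n + 2 - n / 4 - (n + n / 4) / 2 with he
      have he8 : n + 16 ≤ 8 * e := by omega
      have hne : n ≤ 2 ^ e := by have := eight_mul_le_two_pow_add e (by omega); omega
      calc 8 * (m * (p - 1) * 2 ^ ((n + n / m) / 2)) = (8 * (p - 1)) * m * 2 ^ ((n + n / m) / 2) := by ring
        _ ≤ (8 * (p - 1)) * n * 2 ^ ((n + n / 4) / 2) :=
            Nat.mul_le_mul (Nat.mul_le_mul_left _ hmn') (hpow _ _ (by omega))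
        _ < 2 ^ (n / 4) * n * 2 ^ ((n + n / 4) / 2) := by
            have hpos : 0 < n * 2 ^ ((n + n / 4) / 2) := Nat.mul_pos (by omega) (pow_pos two_pos _)
            have := Nat.mul_lt_mul_of_pos_right hp8 hpos
            simpa only [mul_assoc] using this
        _ ≤ 2 ^ (n / 4) * 2 ^ e * 2 ^ ((n + n / 4) / 2) := Nat.mul_le_mul_right _ (Nat.mul_le_mul_left _ hne)
        _ = 2 ^ (n / 4 + e + (n + n / 4) / 2) := by rw [hmul, hmul]
        _ ≤ 2 ^ (n + 2) := hpow _ _ (by omega)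
  have h2n : 2 ^ (n + 1) = 2 * 2 ^ n := by rw [pow_succ, mul_comm]
  have h4n : 2 ^ (n + 2) = 4 * 2 ^ n := by rw [pow_add]; norm_num; rw [mul_comm]
  omega

/-- **The count for `p = 3` at `16 ≤ n ≤ 19`** (below the range of `count_of_le_two_pow`), by evaluation. [folklore] -/
theorem count_three_small (n : ℕ) (h16 : 16 ≤ n) (h19 : n ≤ 19) :
    ∀ m, 2 ≤ m → m ∣ n → 2 * 3 * n * 2 ^ (n / 2) + m * (3 - 1) * 2 ^ ((n + n / m) / 2) < 2 ^ n := by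
  intro m hm hmn
  have hmle : m ≤ n := Nat.le_of_dvd (by omega) hmn
  interval_cases n <;> interval_cases m <;> revert hmn <;> decide

/-- **The count for `p = 3`**: `16 ≤ n` (i.e. `|G| = 6n ≥ 96`) ⟹ for every `m ≥ 2` dividing `n`:
`6n·2^(n/2) + 2m·2^((n + n/m)/2) < 2^n`. [folklore] -/
theorem count_three (n : ℕ) (h16 : 16 ≤ n) :
    ∀ m, 2 ≤ m → m ∣ n → 2 * 3 * n * 2 ^ (n / 2) + m * (3 - 1) * 2 ^ ((n + n / m) / 2) < 2 ^ n := by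
  by_cases h19 : n ≤ 19
  · exact count_three_small n h16 h19
  · refine count_of_le_two_pow 3 n (by norm_num) h16 ?_
    calc (8 * 3 : ℕ) ≤ 2 ^ 5 := by norm_num
      _ ≤ 2 ^ (n / 4) := Nat.pow_le_pow_right two_pos (by omega)

/-- **The count for `p = 3` with at least `7` conjugates at `n = 14`** (`|G| = 84`, e.g. `(C₇ ⋊ C₃) × C₄`), by evaluation. [folklore] -/
theorem count_three_seven_fourteen :
    ∀ m, 7 ≤ m → m ∣ 14 → 2 * 3 * 14 * 2 ^ (14 / 2) + m * (3 - 1) * 2 ^ ((14 + 14 / m) / 2) < 2 ^ 14 := by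
  intro m hm hmn
  have hmle : m ≤ 14 := Nat.le_of_dvd (by omega) hmn
  interval_cases m <;> revert hmn <;> decide

/-- **The count for `p = 3` from `14 ≤ n`** (`|G| = 6n ≥ 84`; `n = 13` fails): `n ∈ {14, 15}` by evaluation, then `count_three`.
[folklore] -/
theorem count_three_of_fourteen_le (n : ℕ) (h14 : 14 ≤ n) :
    ∀ m, 2 ≤ m → m ∣ n → 2 * 3 * n * 2 ^ (n / 2) + m * (3 - 1) * 2 ^ ((n + n / m) / 2) < 2 ^ n := by
  by_cases h16 : 16 ≤ n
  · exact count_three n h16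
  intro m hm hmn
  have hmle : m ≤ n := Nat.le_of_dvd (by omega) hmn
  interval_cases n <;> interval_cases m <;> revert hmn <;> decide

/-- **The count for `p = 2` from `13 ≤ n`** (`|G| = 4n ≥ 52`; at `n = 12` it fails — by equality — exactly at `m = 2`): improves the
threshold `64` of gen 32's involution theorem to `52`. [folklore] -/
theorem count_two (n : ℕ) (h13 : 13 ≤ n) :
    ∀ m, 2 ≤ m → m ∣ n → 2 * 2 * n * 2 ^ (n / 2) + m * (2 - 1) * 2 ^ ((n + n / m) / 2) < 2 ^ n := by
  by_cases h16 : 16 ≤ n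
  · exact count_of_le_two_pow 2 n le_rfl h16 (by
      calc (8 * 2 : ℕ) = 2 ^ 4 := by norm_num
        _ ≤ 2 ^ (n / 4) := Nat.pow_le_pow_right two_pos (by omega))
  intro m hm hmn
  have hmle : m ≤ n := Nat.le_of_dvd (by omega) hmn
  interval_cases n <;> interval_cases m <;> revert hmn <;> decide

/-- **The count for `p = 2` at `n = 12`** (`|G| = 48`) for `m ≥ 3`: three conjugates suffice (row `GL(2,3)`). [folklore] -/
theorem count_two_twelve (m : ℕ) (hm : 3 ≤ m) (hmn : m ∣ 12) :
    2 * 2 * 12 * 2 ^ (12 / 2) + m * (2 - 1) * 2 ^ ((12 + 12 / m) / 2) < 2 ^ 12 := by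
  have hmle : m ≤ 12 := Nat.le_of_dvd (by norm_num) hmn
  interval_cases m <;> revert hmn <;> decide

/-- **The count for `p = 5` from `17 ≤ n`** (`|G| = 10n ≥ 170`): `n ∈ [17, 23]` by evaluation, then `count_of_le_two_pow`. [folklore] -/
theorem count_five (n : ℕ) (h17 : 17 ≤ n) :
    ∀ m, 2 ≤ m → m ∣ n → 2 * 5 * n * 2 ^ (n / 2) + m * (5 - 1) * 2 ^ ((n + n / m) / 2) < 2 ^ n := by
  by_cases h24 : 24 ≤ n
  · exact count_of_le_two_pow 5 n (by norm_num) (by omega) (by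
      calc (8 * 5 : ℕ) ≤ 2 ^ 6 := by norm_num
        _ ≤ 2 ^ (n / 4) := Nat.pow_le_pow_right two_pos (by omega))
  intro m hm hmn
  have hmle : m ≤ n := Nat.le_of_dvd (by omega) hmn
  interval_cases n <;> interval_cases m <;> revert hmn <;> decide

/-- **The count for `p = 7` from `17 ≤ n`** (`|G| = 14n ≥ 238`): `n ∈ [17, 23]` by evaluation, then `count_of_le_two_pow`. [folklore] -/
theorem count_seven (n : ℕ) (h17 : 17 ≤ n) :
    ∀ m, 2 ≤ m → m ∣ n → 2 * 7 * n * 2 ^ (n / 2) + m * (7 - 1) * 2 ^ ((n + n / m) / 2) < 2 ^ n := by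
  by_cases h24 : 24 ≤ n
  · exact count_of_le_two_pow 7 n (by norm_num) (by omega) (by
      calc (8 * 7 : ℕ) ≤ 2 ^ 6 := by norm_num
        _ ≤ 2 ^ (n / 4) := Nat.pow_le_pow_right two_pos (by omega))
  intro m hm hmn
  have hmle : m ≤ n := Nat.le_of_dvd (by omega) hmn
  interval_cases n <;> interval_cases m <;> revert hmn <;> decide

end Summit.HodgeConjecture.CorCM.GaloisModels.SkewSectionPrime
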